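import Mathlib.NumberTheory.Cyclotomic.Gal
import Mathlib.RingTheory.Polynomial.Cyclotomic.Roots
import Mathlib.NumberTheory.DirichletCharacter.Basic
import Mathlib.RingTheory.TensorProduct.Basic
import Literature.NumberTheory.GaloisRepresentations.CyclotomicLevels
import Literature.NumberTheory.EllipticCurves.TateModuleContinuityProofs
import Literature.NumberTheory.EllipticCurves.TateModuleFreeProofs
import Literature.NumberTheory.EllipticCurves.PAdicLFunctionMinus
import Literature.NumberTheory.EllipticCurves.CuspFormLFunction
import HarnessLib

/-!
# Kato 2004 (Astérisque 295), Example 13.3 with (8.1.3), Prop. 8.12, §8.2/Lemma 8.5, Thm. 9.7 and Thm. 6.6 (1): the `a(A)`-type `p`-adic zeta elements of the newform of an elliptic curve over `ℚ` form an EULER SYSTEM of classes unramified away from `p`, whose dual-exponential values at `p` are RATIONAL and have character sums equal to `S`-depleted twisted `L`-values times a four-cusp period combination (ONE named fact; the dual exponential is an abstract datum inside the statement)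

Topic `NumberTheory/EllipticCurves`, sub-directory `Kato2004` (namespace = path,
`Literature.NumberTheory.EllipticCurves.Kato2004`). ONE named fact (`exists_eulerSystem_expStar_values`,
a CLOSED `def … : Prop`, D-0014) preceded by its MATRIX `ZetaBody` — a plain predicate on the explicit
witnesses `(κ, Λ, z, x)`, so that a consumer's row END can bind the witnesses and add its own hypotheses
about them (`hIdx`, `hNorm`), which an `∃`-statement could not carry (ROUTE-1 §47.2 (A), finding F-wit) —
stated as a SPECIAL CASE of print (weight `k = 2`, `F = ℚ`, `r = r' = j = 1`, `ξ = a(A)`, squarefree odd tame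
level; ALL levels `m = p^k · r`, `k ≥ 0`, with `p ∈ S_m := prime(m·p·A)` as (8.1.2) demands — Ex. 13.3's
`Ξ` is the sub-family `p ∣ m`), weaker-or-equal to print clause by clause, and nothing else: no definition of the
zeta elements (Siegel units → `K₂` → Chern class, §§2, 8 — not in the tree), no `B_dR`/`D_dR`/dual
exponential (the value functional is an abstract datum INSIDE the existential, design O1 of the consuming
cell), no proof. Consumer: the `b2b-bsdres` residual cell, team n1011 (class X4 at the additive prime `3`,
route-1 PORT `T-PORT-1` / THEOREMS B–C of `T-DER`): the fact replaces the provenance sentence "Kato's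
Euler system with its explicit reciprocity law" in every `DICT3` consumer by a name; it closes nothing by
itself.

## The printed statements (quoted from the page images; `[p. N]` = printed page, PDF page `N − 115`)

* **§13.1, the definition** [p. 224]. "Let `L` be a finite extension of `ℚ_p` and let `T` be a free
  `O_L`-module of finite rank endowed with a continuous `O_L`-linear action of `Gal(ℚ̄/ℚ)` which is
  unramified at almost all prime numbers. Let `Σ` be a finite set of prime numbers containing `p` and all
  prime numbers at which the action of `Gal(ℚ̄/ℚ)` on `T` ramifies, and let
  `Ξ = {m ≥ 1 ; prime(m) ∩ Σ = {p}}`. For a prime number `ℓ` which is not contained in `Σ`, let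
  `P_ℓ(t) = det_{O_L}(1 − Fr_ℓ · t : T → T) ∈ O_L[t]` where `Fr_ℓ` is the arithmetic Frobenius at `ℓ`.
  By an Euler system for `(T, L, Σ)`, we mean a system of elements `z_m ∈ H¹(ℤ[ζ_m, 1/p], T)` defined
  for `m ∈ Ξ`, satisfying the following condition. **(13.1.1)** [p. 225] For `m, m′ ∈ Ξ` such that
  `m ∣ m′`, the norm map `H¹(ℤ[ζ_{m′}, 1/p], T) → H¹(ℤ[ζ_m, 1/p], T)` sends `z_{m′}` to
  `(∏_ℓ P_ℓ(ℓ⁻¹σ_ℓ⁻¹))·z_m` where `ℓ` ranges over all prime numbers which divide `m′` but do not divide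
  `m`, `σ_ℓ` is the arithmetic Frobenius of `ℓ` in `Gal(ℚ(ζ_m)/ℚ)`, and we regard `P_ℓ(ℓ⁻¹σ_ℓ⁻¹)` as
  an element of the group ring `O_L[Gal(ℚ(ζ_m)/ℚ)]`."  (Ex. 13.2, p. 225: for `T = ℤ_p(1)`,
  "`P_ℓ(t) = 1 − ℓt`, `P_ℓ(ℓ⁻¹σ_ℓ⁻¹) = 1 − σ_ℓ⁻¹`" — `Fr_ℓ` in `P_ℓ` is arithmetic, NO inverse.)
  Galois convention (Prop. 5.3 / p. 155, (5.7.1) p. 157): "`σ_ℓ ∈ Gal(ℚ(ζ_m)/ℚ)`; `σ_ℓ(ζ_m) = ζ_m^ℓ`",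
  "`(b 0; 0 1)^* = σ_b` for `b ∈ (ℤ/m)^×`" ((5.7.1) is printed at the foot of p. 157, "on
  `K₂(Y₁(N) ⊗ ℚ(ζ_m))`, `M_k(X₁(N) ⊗ ℚ(ζ_m))` (`k ∈ ℤ`), and `V_{k,ℚ}(Y₁(N)) ⊗ ℚ(ζ_m)`"; p. 158: "The
  proofs of (5.7.1)–(5.7.3) are easy and hence omitted").
* **Example 13.3** [p. 225]. "Let `λ` be a place of `F` lying over `p`, let `r ∈ ℤ`, and let
  `T = V_{O_λ}(f)(k − r)`. Fix an integer `j` such that `1 ≤ j ≤ k − 1`, and fix non-zero integers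
  `c, d`. Let `ξ` be either a symbol of the form `a(A)` (`a, A ∈ ℤ`, `A ≥ 1`) or an element of
  `SL₂(ℤ)`. In the case `ξ = a(A)`, we assume `(c, 6pA) = 1` and `(d, 6pN) = 1`. In the case
  `ξ ∈ SL₂(ℤ)`, we assume `(cd, 6pN) = 1`. By fixing these, let `Σ = prime(cdpAN)` in the case
  `ξ = a(A)`, and let `Σ = prime(cdpN)` in the case `ξ ∈ SL₂(ℤ)`. For `m ∈ Ξ`, define
  `z_m ∈ H¹(ℤ[ζ_m, 1/p], T)` by `z_m = _{c,d}z_m^{(p)}(f, r, j, ξ, prime(mA))` if `ξ = a(A)`,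
  `_{c,d}z_m^{(p)}(f, r, j, ξ, prime(mN))` if `ξ ∈ SL₂(ℤ)`. Then `(z_m)_m` is an Euler system for
  `(T, F_λ, Σ)`. In fact, for a prime number `ℓ` which does not divide `Np`, we have
  `det_{O_L}(1 − Fr_ℓ⁻¹ · t; V_{F_λ}(f)) = 1 − a_ℓ t + ε(ℓ) ℓ^{k−1} t²` […]. Hence
  `P_ℓ(t) = det_{O_L}(1 − Fr_ℓ · t; T) = 1 − ā_ℓ ℓ^{1−r} t + ε̄(ℓ) ℓ^{k+1−2r} t²`,
  `P_ℓ(ℓ⁻¹σ_ℓ⁻¹) = 1 − ā_ℓ ℓ^{−r} σ_ℓ⁻¹ + ε̄(ℓ) ℓ^{k−1−2r} σ_ℓ⁻²`. Hence `(z_m)_m` is an Euler System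
  for `(T, F_λ, Σ)` by Prop. 8.12."  — NO hypothesis on the reduction of `f` at `p`, NO image
  hypothesis, `p ∣ N` allowed, `p = 2` allowed; the only arithmetic conditions are `(c, 6pA) = 1`,
  `(d, 6pN) = 1`, `c, d ≠ 0`.
* **(8.1.3)** [p. 180] "`_{c,d}z^{(p)}_m(f, r, r′, ξ, S) ∈ H¹(ℤ[1/p, ζ_m], V_{O_λ}(f)(k − r))` where
  `m ≥ 1`, `f = Σ_{n≥1} a_n q^n` is a normalized newform in `M_k(X₁(N)) ⊗ ℂ` (`N ≥ 1`), `ξ, S, r, r′,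
  c, d` are as in (8.1.2), `λ` is a finite place of `F = ℚ(a_n ; n ≥ 1)`, and `O_λ` is the valuation
  ring of `λ`"; (8.1.2): "`ξ, S` are as in (5.1.1), `p ∈ S`, and `r, r′, c, d` are integers satisfying
  `1 ≤ r′ ≤ k − 1`, `prime(cd) ∩ S = ∅`, `(cd, 6) = 1`, `(d, N) = 1`"; (5.1.1) [p. 152]: "Either `ξ`
  is a symbol `a(A)` where `a, A ∈ ℤ`, `A ≥ 1` and `S` is a non-empty finite set of primes containing
  `prime(mA)`, or `ξ` is an element of `SL₂(ℤ)` and `S` is a non-empty finite set of prime numbers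
  containing `prime(mN)`."  §8.11 [p. 186]: the elements (8.1.3) are the images of (8.1.2) under
  `V_{k,ℤ_p}(Y₁(N)) → V_{O_λ}(f)`.  NB: `r ∈ ℤ` is NOT constrained in (8.1.1)–(8.1.3); `1 ≤ r ≤ k − 1`
  with one of `r, r′` equal to `k − 1` enters only in the VALUE theorems 9.5–9.7 / 6.6.

* **§8.3, the lattice** [p. 181]. "Let `V_{O_λ}(f)` be the `O_λ`-submodule of `V_{F_λ}(f)` (6.3)
  generated by the image of `V_{k,ℤ_p}(Y₁(N))`" — where "the étale cohomology group
  `H¹(Y(M, N) ⊗ ℚ̄, Sym^{k−2}_{ℤ_p}(ℋ¹_p) ⊗_{ℤ_p} A)` for `A = ℤ_p, ℚ_p` or `ℤ/pⁿ` … is identified with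
  `V_{k,A}(Y(M, N)) = H¹(Y(M, N)(ℂ), Sym^{k−2}_ℤ(ℋ¹) ⊗ A)` (4.5.1). Thus, for such `A`, `V_{k,A}(Y(M, N))`
  is endowed with a canonical action of `Gal(ℚ̄/ℚ)`. This action is unramified at any prime number which
  does not divide `pMN`" [p. 182: `V_{O_λ}(f)` is a `Gal(ℚ̄/ℚ)`-stable `O_λ`-lattice of `V_{F_λ}(f)`].
  This `V_{O_λ}(f)` (twisted) is THE coefficient module of (8.1.3), Ex. 13.3, Thm. 12.6 and 13.12–13.14.
* **Prop. 8.12** [p. 186]. "Let the notation be as in (8.1.3). Let `m′ ≥ 1`, `m ∣ m′`, let `S′` be a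
  finite set of prime numbers such that `S ∪ prime(m′) ⊂ S′` and `prime(cd) ∩ S′ = ∅`. Then the norm map
  `H¹(ℤ[ζ_{m′}, 1/p], V_{O_λ}(f)) → H¹(ℤ[ζ_m, 1/p], V_{O_λ}(f))` sends `_{c,d}z^{(p)}_{m′}(f, r, r′, ξ, S′)`
  to `(∏_{ℓ∈S′−S} (1 − ā_ℓ σ_ℓ⁻¹ · ℓ^{−r} + ε̄(ℓ) σ_ℓ⁻² · ℓ^{k−1−2r})) · _{c,d}z^{(p)}_m(f, r, r′, ξ, S)`."
  [ERRATUM (E5), print-internal: the display omits the twist `(k − r)` carried by (8.1.3); the Euler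
  factor printed is the one of `V_{O_λ}(f)(k − r)`; read with the twist.]
* **§8.2, where the classes live** [pp. 180–181]. "for a ring `R`, we denote the étale cohomology group
  `H^q_ét(Spec(R), )` simply by `H^q(R, )`. In the case `R` is an integral domain with field of fractions
  `K`, we denote `H^q(R, j_*(𝔄))` simply by `H^q(R, 𝔄)` […] `j : Spec(K) → Spec(R)` […]. Let […] `R` be
  a ring of the form `O_K[a⁻¹]` for some `a ∈ O_K ∖ {0}` such that `p` is invertible in `R`. For a
  finitely generated `ℤ_p`-module `T` endowed with […] a continuous action of `Gal(K̄/K)` which is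
  unramified at almost all finite places of `K`, we denote `H^q(R, T) =_{def} lim←_n H^q(R, T/p^n)`."
  **Lemma 8.5** ([Pe0, 2.2.4], [Ru4, B3.3]) [pp. 183–184]: "(1) For any set `S` of finite places of `K`
  containing all places lying over `p`, the canonical map `H¹(O_K[S⁻¹], T) → H¹(K, T)` is injective.
  (2) The image of `lim←_n H¹(K(ζ_{p^n}), T) → H¹(K, T)` is contained in the image of
  `H¹(O_K[1/p], T) → H¹(K, T)`", with, in the proof [p. 184], "`H¹(O_v, T) = H¹(Gal(K_v^{ur}/K_v),
  H⁰(K_v^{ur}, T))` […] and hence `H¹(O_v, T) → H¹(K_v, T)` is injective" for EVERY maximal ideal `v`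
  of `O_K[1/p]`.  ⇒ membership `z_m ∈ H¹(ℤ[ζ_m, 1/p], T)` MEANS: the localisation of `z_m` at every
  finite place `w ∤ p` of `ℚ(ζ_m)` — the places over `N` (where `T_pE` ramifies), over `m` and over
  `cdA` INCLUDED — lies in `ker(H¹(ℚ(ζ_m)_w, T) → H¹(ℚ(ζ_m)_w^{ur}, T))` (CLASS-level unramified; where
  `T` is unramified at `w`, i.e. `w ∤ pN`, this equals the cocycle-level statement "every representative
  vanishes on inertia"). [Design D3 of record = this clause at class level "∀ w ∤ p" (T-PORT-1-PKATO
  STATUS v4; ERRATUM (E7): the earlier paraphrase "unramified outside pΣm" UNDERSTATES print).]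
* **§9.4 and Thm. 9.7, the dual exponential and RATIONALITY** [pp. 188–189]. "We have the dual
  exponential map `exp*_f : H¹(ℚ(ζ_m) ⊗ ℚ_p, V_{F_λ}(f)(i)) → S(f) ⊗_F F_λ ⊗ ℚ(ζ_m)` for
  `1 ≤ i ≤ k − 1`." "**Theorem 9.7.** — Let the notation be as in (8.1.3). Assume `1 ≤ r ≤ k − 1`, and
  at least one of `r, r′` is `k − 1`. Let `F, λ, F_λ` be as in 8.3. Then the map
  `exp*_f : H¹(ℚ(ζ_m) ⊗ ℚ_p, V_{F_λ}(f)(k − r)) → S(f) ⊗_F F_λ ⊗ ℚ(ζ_m)` sends the image of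
  `_{c,d}z^{(p)}_m(f, r, r′, ξ, S)` to `_{c,d}z_m(f, r, r′, ξ, S) ∈ S(f) ⊗ ℚ(ζ_m) ⊂ S(f) ⊗_F F_λ ⊗ ℚ(ζ_m)`."
  — the value is RATIONAL (lies in `S(f) ⊗ ℚ(ζ_m)`); `S(f)` [§6.3, pp. 161–162] is the
  one-dimensional `F`-vector space quotient of `M_k(X₁(N)) ⊗ F` by the `T(n) ⊗ 1 − 1 ⊗ a_n`, with the
  period map `per_f : S(f) → V_ℂ(f)`, `V_F(f)` the two-dimensional `f`-quotient of `V_{k,F}(Y₁(N))`,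
  `dim V_F(f)^± = 1` for the complex conjugation `ι`, and `δ(f, j, ξ) ∈ V_F(f)` the image of
  `δ_{1,N}(k, j, ξ)`.
* **§6.2, the `S`-depleted twisted `L`-function** [p. 161]. "For `m ≥ 1` and for a finite set `S` of
  prime numbers such that `prime(m) ⊂ S`, and for a character `χ : (ℤ/m)^× → ℂ^×`, let
  `L_S(f, χ, s) = Σ_{(n,S)=1} a_n χ(n) n^{−s} = ∏_{ℓ∉S} (1 − a_ℓ χ(ℓ) ℓ^{−s} + ε(ℓ) χ²(ℓ) ℓ^{k−1−2s})⁻¹`.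
  These zeta functions converge absolutely when `Re(s) > (k + 1)/2`, and are extended as holomorphic
  functions to the whole `s`-plane."  §6.5 [p. 163]: "`f* = Σ ā_n q^n`".
* **Thm. 6.6 (1), the VALUE LAW** [p. 163]. "Let `ξ, S` be as in (5.1.1). Let `χ : (ℤ/m)^× → ℂ^×`
  be a character. (1) […] let `r, r′, c, d` be integers satisfying (5.2.1) (5.2.2). In the case
  `ξ ∈ SL₂(ℤ)`, assume `c ≡ d ≡ 1 mod N`. Let `± = (−1)^{k−r−1}χ(−1)` and let `u, v ∈ ℤ` be as in
  (4.2.4). Then `Σ_{b∈(ℤ/m)^×} χ(b) per_f(σ_b(_{c,d}z_m(f, r, r′, ξ, S)))^± = L_S(f*, χ, r) · (2πi)^{k−r−1} · γ^±`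
  where `γ = c²d² δ(f, r, r′, a(A)) − c^u d² χ̄(c) δ(f, r′, ac(A)) − c² d^v χ̄(d) ε(d) δ(f, r′, “a/d”(A))
  + c^u d^v χ̄(cd) ε(d) δ(f, r′, ξ)` in the case `ξ = a(A)`" with (5.2.1) [p. 153] "`1 ≤ r ≤ k − 1`,
  `1 ≤ r′ ≤ k − 1`, at least one of `r, r′` is `k − 1`", (5.2.2) "`prime(cd) ∩ S = ∅`, and `(d, N) = 1`",
  and **(4.2.4)** [p. 143, image-read; OCR garbled] "`(u, v) = (r + 2 − k, r)` if `r′ = k − 1`;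
  `(u, v) = (k − r′, r′)` if `r = k − 1`" [ERRATUM (E1): a reading "(r + 2 − k, r′)" is wrong in the
  second coordinate; immaterial at `k = 2`]. ERRATA carried VERBATIM-PLUS-READING (three internal
  witnesses each: Thm. 5.6 (2) p. 157, Lemma 13.10 (1) p. 230, the product formula (4.2.4)/(13.10.1)):
  (E2) the first term's "`δ(f, r, r′, a(A))`" is `δ(f, r′, a(A))` (`δ` takes three arguments, §6.3) and
  the fourth term's "`δ(f, r′, ξ)`" is `δ(f, r′, “ac/d”(A))`; (E3) the fourth term's sign is `+` (5.6 (2)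
  prints `−`, 6.6 and 13.10 (1) print `+`, and `(c² − c^uX)(d² − d^vY)` gives `+`); (E4) "“a/d” means
  any integer `b` such that `bd ≡ a mod A`, and “ac/d” means any integer `b` such that `bd ≡ ac mod A`"
  (Lemma 13.10 (1), p. 230; Thm. 5.6 p. 157 prints "mod N"; by Cor. 5.10 p. 160 the symbol `b(A)`
  depends on `b mod A` only, and under (5.2.2) with `S ⊇ prime(mA)` `d` is a unit mod `A`).
* **The cusp classes and their periods** (for the modular-symbol dictionary). §5.5 [p. 156]:
  "`δ_{1,N}(2, 1, a(A)) ∈ H¹(Y₁(N)(ℂ), ℚ)` is the image of the class of the route from a cusp to a cusp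
  `(0, ∞) → Y₁(N)(ℂ); y ↦ ν(A⁻¹(yi + a))` in `H₁(X₁(N)(ℂ), {cusps}, ℤ)`"; §4.7 [p. 145]: the
  identification `H¹(Y(ℂ), Sym(ℋ¹)) ≅ H₁(X(ℂ), {cusps}, Sym(ℋ₁))` "is by Poincaré duality"; §4.5
  [p. 144]: "`ι` […] the map induced by the complex conjugation on `Y(M,N)(ℂ)` and on `E(ℂ)` […]
  `x^± = ½(1 ± ι)(x)`"; (7.13.1) [p. 168] "a perfect duality `⟨ , ⟩ : V_{k,ℚ}(Y₁(N)) × V_{k,ℚ,c}(Y₁(N)) → ℚ`";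
  (7.13.5) [p. 169] "`⟨per(g), ι′per(f)⟩ = (−8π²i)^{k−1} ∫_{Γ₁(N)\ℍ} \overline{f(τ)} g(τ) y^{k−2} dx ∧ dy`";
  (7.13.6) "`⟨δ_{1,N}(k, j), per(f)⟩ = Ω(f, j)`" with §7.6 [p. 166] "`Ω(f, j) = (2πi)^{k−1} ∫_0^∞ f(iy)(iy)^{j−1} d(iy)`,
  (7.6.1) `Ω(f, j) = (2πi)^{k−j−1}(−1)^j (j − 1)! L(f, j)`"; p. 231 (proof of 13.11): "`⟨δ(f, k−1, a(A)), f*⟩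
  = (−2π)^{k−1} · A^{k−2} · ∫_0^∞ f*(yi + a/A) y^{k−2} dy`".
* **Lemma 13.11 (2), when a conductor-`A` combination is non-zero** [p. 231]. "The element
  `Σ_{a∈(ℤ/A)^×} ν(a) δ(f, k − 1, a(A))` of `V_F(f) ⊗ ℚ̄` is not zero if `L_{prime(A)}(f*, ν⁻¹, k − 1) ≠ 0`
  and if the conductor of `ν` is `A`."
* **§6.3 / §5.5 / Thm. 13.6 / 13.7 / 13.9 (the `SL₂(ℤ)` side, for the record)** [pp. 162, 156, 227,
  229]: "`dim_F(V_F(f)) = 2`, `dim_F(V_F(f)⁺) = dim_F(V_F(f)⁻) = 1`"; "`δ_{1,N}(k, j, α)`" for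
  `α ∈ SL₂(ℤ)` is "the image of `α^*(δ_{L,L}(k, j))` under the trace map"; Thm. 13.6 (Ash–Stevens):
  "`V_{k,ℤ}(Y(L))` is generated over `ℤ` by the elements `α^* δ_{L,L}(k, j)`"; proof of 13.7: "for some
  `α ∈ SL₂(ℤ)` and some integer `j` … we have `δ(f, j, α)^± ≠ 0`" — Kato prints EXISTENCE of such `α`,
  never the phrase "`δ(f, j, α)^±` generate `V_F(f)^±`" (with `dim = 1` the same statement). For the
  `a(A)` side the printed non-vanishing statement is Lemma 13.11 (2); `Σ_a ν(a)δ(f, 1, a(A))` lies in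
  `V^{−ν(−1)}`, so `V⁺` is reached by `a(A)`-classes through ODD `ν` of conductor `A` only ((P4)).
* **Thm. 12.5 (1), the Λ-adic form, for the record** [pp. 221–222] (NOT what this fact states; it
  characterises the divided classes `𝐳_γ^{(p)} ∈ 𝐇¹(V_{F_λ}(f))`, `γ ∈ V_{F_λ}(f)`, by "the image […]
  belongs to `S(f) ⊗_ℚ ℚ(ζ_{p^n})`, and the map […] `x ⊗ y ↦ Σ_{σ∈G_n} χ(σ)σ(y) per_f(x)^±` […] sends the
  image of `𝐳_γ^{(p)}` to `(2πi)^{k−r−1} · L_{{p}}(f*, χ, r) · γ^±`", UNIQUE such map; Thm. 12.6 / §13.12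
  [pp. 222, 231]: the Λ-span `Z` of the integral `_{c,d}`-systems has finite index in `Z(f, T)`).

## The elliptic-curve specialisation (what the Lean statement transcribes)

`f = f_E` the newform of `E/ℚ` of conductor `N`: `k = 2`, `a_n ∈ ℤ`, `F = ℚ`, `f* = f` (§6.5),
`ε = 1` (`ε(ℓ) := 0` for `ℓ ∣ N`), `λ = p`, `O_λ = ℤ_p`; `r = r′ = j = 1 = k − 1` satisfy (5.2.1) and
(4.2.1); (4.2.4) gives `(u, v) = (1, 1)`; `± = (−1)^{k−r−1}χ(−1) = χ(−1)`; `(2πi)^{k−r−1} = 1`;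
`T = V_{ℤ_p}(f)(1)`, `det = χ_cyclo` — the `T_pE`-type lattice (for `E[p]` irreducible all
`Gal(ℚ̄/ℚ)`-stable `ℤ_p`-lattices of `V_pE` are homothetic — ELEMENTARY (Nakayama: scale a stable `T′` into
`T = T_pE` with `T′ ⊄ pT`; the image of `T′` in `T/pT = E[p]` is a non-zero stable subspace, hence all of
it, so `T′ + pT = T` and `T′ = T`), a DERIVATION needing no page and valid at every `p`; Kato prints a
homothety statement only under the big-image condition (12.5.2), at (12.8.1) p. 223 ("all
`Gal(ℚ̄/ℚ)`-stable `O_λ`-lattices of `V_{F_λ}(f)` have the form `aT` for some `a ∈ F_λ^×` (see the proof of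
14.7)") and Lemma 14.7 p. 238 — NOT invoked here (erratum E-49 of ROUTE-1 §49.2; n1011-lit GEN 21
E-L2) — so stating the fact on the tree's continuous Tate module `W.tateGaloisRep p _` of the consumer's
`W` under `W.HasIrreducibleModPGaloisRep p` is faithful up to a `ℤ_p^× · p^ℤ`-scaled isomorphism, which
the existential `κ, Λ` absorb — design D1 (a), finding F-κ: no parity of `p` is needed for this
placement. WHICH CURVE: [Wut14, Prop. 8, p. 388] prints
"`V_{ℤ_p}(f)(1) = T_pE_•`" for `p` ODD and `E` SEMISTABLE at `p` only (`E_•` the curve of [Wut14,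
Thm. 4, p. 384]; "does not hold in general for primes `p` of additive reduction or for `p = 2`"); at an
arbitrary `p` the identification `V_{ℤ_p}(f)(1) = T_pE₁` (`E₁` the `X₁(N)`-optimal curve) and, under
`Irr(W[p])`, `≅ T_pW` is the DERIVATION D-W1 (lit-kato gen 18, from [Wut14] proof of Prop. 8 ¶1 +
cusps of `X₁(N)` `ℚ(ζ_N)`-rational) — a reading, never `[cite: Wuthrich2014, Prop. 8]` at an additive
`p`); `ξ = a(A)`: hypotheses `(c, 6pA) = 1`, `(d, 6pN) = 1`,
`c, d ≠ 0` (implied by the two gcd conditions); `Σ = prime(cdpAN)`; levels: EVERY `m ≥ 1` with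
`prime(m) ∩ prime(2cdAN) = ∅` ((8.1.3) p. 180 "`m ≥ 1`", with `S_m := prime(m·p·A) ∋ p` as (8.1.2)
demands; Ex. 13.3's `Ξ` = those with `p ∣ m`; `2 ∤` tame part = design D4);
`z_m = _{c,d}z^{(p)}_m(f, 1, 1, a(A), S_m) ∈ H¹(ℤ[ζ_m, 1/p], T)`; norm relation (13.1.1) with
`P_ℓ(ℓ⁻¹σ_ℓ⁻¹) = 1 − a_ℓ ℓ⁻¹ σ_ℓ⁻¹ + ℓ⁻¹ σ_ℓ⁻²` (`= P_ℓ(ℓ⁻¹X)` at `X = σ_ℓ⁻¹`, `P_ℓ(t) = 1 − a_ℓ t + ℓ t²`;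
this IS the tree's `rubinEulerFactor` of `T_pW` at an arithmetic Frobenius evaluated at
`frobeniusInvOp = σ_ℓ⁻¹`, kernel theorem `Rat.rubinEulerFactor_galoisRepTate` (p302588), so
`IsEulerSystem.cores_cons` is (13.1.1) for `m′ = mℓ`, and `cores_p` is (13.1.1) for `m′ = mp`, where the
product over `ℓ` is EMPTY because `p` already divides `m` — no Euler factor in the `p`-direction);
VALUE LAW (Thm. 9.7 ∘ Thm. 6.6 (1) with (E2)–(E4)): for every level `m` and every character
`χ : (ℤ/m)^× → ℂ^×`, with `S = S_m = prime(m·p·A)`,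
  `exp*_f(loc_p z_m) = _{c,d}z_m(f, 1, 1, a(A), S) ∈ S(f) ⊗ ℚ(ζ_m)` (RATIONAL), and
  `Σ_{b∈(ℤ/m)^×} χ(b) per_f(σ_b(_{c,d}z_m(f,1,1,a(A),S)))^{χ(−1)} = L_S(f, χ, 1) · γ_χ^{χ(−1)}`,
  `γ_χ = c²d² δ(f,1,a(A)) − cd² χ̄(c) δ(f,1,ac(A)) − c²d χ̄(d) δ(f,1,“a/d”(A)) + cd χ̄(cd) δ(f,1,“ac/d”(A))`.
DICTIONARY to the tree's modular symbols (DERIVED, each ≤ 3 lines from the printed (7.13.5)/(7.13.6)/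
(7.6.1)/§5.5/§4.7/p. 231 and the orientation of `F_∞ = (τ ↦ −τ̄)`; `KATO-PAGE-READ-gen16.md` §2):
`per(f) = [2πi f(τ)dτ]`; `⟨δ(f,1,b(A)), per f⟩ = −modularSymbol f (b/A)` (= `−2π∫_0^∞ f(b/A + it)dt`);
`ι δ(route_r) = −δ(route_{−r})`, hence `⟨δ(f,1,b(A))^+, per f⟩ = −minusSymbol f (b/A)` and
`⟨δ(f,1,b(A))^−, per f⟩ = −plusSymbol f (b/A)`; `⟨(per f)^±, per f⟩ = ±4π²i (f,f)_{Γ₁(N)\ℍ}`.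
Consequences the statement must respect: **(P1) parity cross-over** — a character of parity
`ε = χ(−1)` sees the auxiliary cusps `b/A` through the symbols of parity `−ε` (`ratMinusSymbol` for even
`χ`, including `χ = 1`; `ratPlusSymbol` for odd `χ`), while the `L`-value side keeps parity `ε`
(`L_S(f,χ,1)/Ω⁺` resp. `/(iΩ⁻)`); **(P2) one constant** — in the `f̄`-coordinate of `S(f) ⊗ ℂ` the
constant is `∓1/(4π²i(f,f))`, i.e. ONE real `κ_f = −Ω⁺Ω⁻/(4π²(f,f)_{Γ₁(N)\ℍ}) ≠ 0` for all
`(m, χ, c, d, a, A)` in `Ω`-currency (NOT `1/Ω^±`; "`κ_f ∈ ℚ^×`" would be the modular-degree formula,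
which is NOT in Kato — not asserted); **(P4)** for `A ∈ {1, 2}` every even-character value (incl.
`χ = 1`) VANISHES (`[b/A]⁻ = 0` when `b/A ≡ −b/A`); a usable `A` is one with a non-vanishing ODD twist
of conductor `A` (Lemma 13.11 (2)) — a per-`(E, A)` matter for the consumer, not a clause of the fact.

## What is print, what is a reading, what is design (one line each; the consuming cell's labels)

O1 (exp* side an ABSTRACT datum inside `∃`): DESIGN — print defines `exp*_f` (§9.4) via `D_dR`, absent
from the tree; the datum `Λ_{k,r} : H¹(ℚ(μ_m), T_pW) →ₗ[ℤ_p] ℚ_p ⊗_ℚ ℚ(ζ_m)` is ONE global map per level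
("`exp*_{f̄} ∘ loc_p`"), its axioms X1-eq (Galois-equivariance) and X1-loc (locality at `p`) are
READINGS of §9.4 carried inside `ZetaBody` with their own attribution. F-wit (two declarations): DESIGN
(ROUTE-1 §47.2 (A)). B5 (complex embeddings `ι_m` universally quantified, no pin — by design): with
`∃ Λ ∃ x` AFTER `ι`, a change of embeddings `ι_m ↦ ι_m ∘ τ_m` is compensated LEVEL-WISE inside the
existentials (`Λ_m ↦ (1 ⊗ τ_m⁻¹) ∘ Λ_m`, `x_m ↦ τ_m⁻¹ x_m`; F-ι-0, rider R-ι of ROUTE-1 §48.2): this is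
sound exactly because `ZetaBody` carries NO cross-level axiom on `Λ` or `x` (no corestriction/trace
compatibility, X1-nat) — KEEP IT SO; a later version adding one must restrict `ι` to compatible families
(`ι_m = ι_{m′}|ℚ(ζ_m)`) or pin it. Kato's own `ℚ(ζ_m) ⊂ ℂ` is one admissible family; a pin on
`IsCyclotomicExtension.zeta` would name no embedding (opaque choice) and is not used. D1 (a) (state on `W.tateGaloisRep p _` under `E[p]` irreducible): all
`Gal(ℚ̄/ℚ)`-stable `ℤ_p`-lattices of `V_pW` are homothetic under `Irr(W[p])` — ELEMENTARY (Nakayama), a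
DERIVATION needing no page; Kato states homothety under (12.5.2) in (12.8.1) p. 223 / Lemma 14.7 p. 238,
which is NOT invoked (E-49 / E-L2) — + Wuthrich 2014's lattice remark (Kato's lattice is `T_pE_•` of a
curve in the isogeny class, [Wut14] Thm. 4 p. 384 / Prop. 8 p. 388 — journal paging per ST-45c, read by
this lineage in gen 18 from the text layer of the EMS Press OA PDF; odd semistable `p` only). D2′ (levels): ALL levels `k ≥ 0` are PRINT — (8.1.2)–(8.1.3) p. 180 define the classes for every
`m ≥ 1` with `p ∈ S`, Prop. 8.12 p. 186 relates every `m ∣ m′` (so `Cor z_{mp} = z_m`, empty Euler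
product, and the tame relations hold at `k = 0` too), Thm. 9.7 / 6.6 give the values at every `m`; only
Def. 13.1's `Ξ` restricts Ex. 13.3's sentence to `p ∣ m` (two seats' image read of p. 180). Squarefree
tame part = SPECIAL CASE of print — say so, `-- TODO(general form)`. D3 (class-level unramified at every
`w ∤ p`): PRINT (13.1 + §8.2 + Lemma 8.5, pp. 180–184, 224). D4 (`2 ∈ S`, i.e. odd tame levels only):
DESIGN, a SPECIAL CASE of print — Kato's `Σ = prime(cdpAN)` contains `2` only when `2 ∣ pAN` (`c, d` are
prime to `6`), so for odd `pAN` his `Ξ` also has even `m`; restricting the family to `2 ∤ r` keeps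
(13.1.1) among the retained levels and loses nothing the consumer uses (Kolyvagin primes are
`≡ 1 mod p^k`). X1-eq / X1-loc (per-level `ℤ_p`-linear `Λ`, Galois-equivariant, local at `p`): READINGS
of §9.4 (exp* is defined on the semi-local cohomology at `p` and is Galois-natural) — axioms of the
abstract datum inside `ZetaBody`, own attribution. NOT in the fact: X1-nat (compatibility of `Λ` with
corestriction — unnecessary, the classes and values are printed at every level), X1-int (any integrality
`p^c Λ(H¹(T)) ⊆ …` — NOT a Kato 2004 statement at an additive `p`; Kato's integrality statements
12.5 (4) / 12.6 / 13.12 concern the CLASSES, under `p ≠ 2` + (12.5.2) resp. up to an inexplicit index —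
it is the consumer's `hIdx`, [BK90]/local duality), X2 (`ker Λ ⊗ ℚ = H¹_f`, Bloch–Kato 1990 §3 — not
printed in Kato 2004 and not typable at the level fields in the tree: no completions of level fields;
its typable half is X1-loc; the kernel/index statement is the consumer's `hIdx` at the bottom level). X3 (value law): PRINT (Thm. 9.7 + Thm. 6.6
(1) + (E1)–(E4)) in `per_f`/`δ` currency; the modular-symbol form is the DERIVED dictionary above (shape
(β): `∃ κ : ℝ, κ ≠ 0 ∧ ∀ …`, two parity clauses, `L_S` = the entire continuation of the tree's
`twistedLSeries f (χ.changeLevel (dvd_mul_right m A))`, rationality clause `x_m ∈ ℚ(ζ_m)` KEPT —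
elaborates on tree objects, scratch `gen16/PKatoValueShapeProbe.lean` rc 0). X4 (mod-`p^k` factoring):
DESIGN, only if THEOREM B needs it literally.

## What is NOT asserted and NOT in print (do not let the docstring suggest otherwise)

No reduction hypothesis at `p`, no image hypothesis, no `p ∤ N`, no `p ≠ 2` for existence + norm
relations + unramifiedness + values (Ex. 13.3, Prop. 8.12, Lemma 8.5, Thm. 9.7, Thm. 6.6 carry none);
those enter only the DIVISIBILITY statements 12.4 (3) / 12.5 (4) / 13.4 (3) / 17.4 (not this fact). The
Kolyvagin congruence / derivative descent is NOT printed in Kato 2004 (Thm. 13.4 p. 226 is "By [Pe4, Ru4,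
KK4]"); it is the tree's THEOREMS A–C. "`κ_f ∈ ℚ^×`", the Manin constant, and any `exp*`-integrality
constant at an additive prime are NOT Kato 2004. Twisting zeta elements by characters is Rubin, *Euler
Systems* Ch. VI / II §4, not Kato. No value law of the shape "`exp*_{ω_E}(z) = L_S(E,1)/Ω⁺_E`" is
printed in Kato 2004 or [Wut14]: Kato prints the values coordinate-free (Thm. 6.6 (1) + 9.7) and the
`ω`-normalisation only as the DEFINITION "`per(ω) = Ω₊γ⁺ + Ω₋γ⁻`" (Thm. 16.2 p. 269, Rem. 16.3 (2);
§17.5 good ordinary); at an additive prime 16.1's `α` does not exist, §16–§17 are silent — the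
row-coordinate constant (rider R-κ) is the consumer's `hNorm`, never under `[cite: Kato2004Asterisque]`.
The fact pins NO sign relation between even- and odd-character values and NO particular complex
embedding: the witness maps `(κ, Λ, z, x) ↦ (κ, (1 ⊗ σ_j⁻¹) ∘ Λ, z, σ_j⁻¹ x)` move between them
(n1011-lit GEN 21; F-ι-0) — no consumer may read either.

## References

* K. Kato, *p-adic Hodge theory and values of zeta functions of modular forms*, Astérisque 295 (2004)
  117–290: §4.2 (4.2.4) p. 143; §4.5 p. 144; §4.7 p. 145; §5.1 (5.1.1) p. 152; §5.2 (5.2.1)–(5.2.2)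
  p. 153; Prop. 5.3 p. 155; §5.5 p. 156; Thm. 5.6, §5.7 (5.7.1) p. 157 (proofs-omitted note p. 158);
  Cor. 5.10 p. 160; §6.2–6.3 pp. 161–162; §6.5, Thm. 6.6 p. 163; §7.6 (7.6.1) p. 166; (7.13.1),
  (7.13.5), (7.13.6) pp. 168–169; §8.1 (8.1.2)–(8.1.3) p. 180; §8.2 pp. 180–181; Lemma 8.5 pp. 183–184;
  §8.9 p. 185; §8.11, Prop. 8.12 p. 186; §9.4 p. 188; Thm. 9.7 p. 189; Thm. 12.5 (1) pp. 221–222;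
  Thm. 12.6, Rem. 12.7 p. 222; Rem. 12.8, (12.8.1) p. 223; §13.1, (13.1.1), Ex. 13.2, Ex. 13.3
  pp. 224–225; §13.9–Lemma 13.11 pp. 229–231; §13.12 p. 231; Lemma 14.7 p. 238 (lattice homothety under
  (12.5.2) — located, not invoked). [Kato2004Asterisque]
* K. Rubin, *Euler Systems*, Ann. of Math. Studies 147 (2000), Def. 2.1.1 / Remark 2.1.4 (the tree's
  `IsEulerSystem`), App. B.3.3 (= Kato's Lemma 8.5 citation [Ru4]). [Rubin2000]
* C. Wuthrich, *On the integrality of modular symbols and Kato's Euler system for elliptic curves*,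
  Doc. Math. 19 (2014) 381–402, doi:10.4171/dm/450: Thm. 4 p. 384, Prop. 8 p. 388 (the lattice
  `V_{ℤ_p}(f)(1) = T_pE_•`, odd semistable `p`), §3.2 p. 394. [Wuthrich2014]
* R. Greenberg, V. Vatsal, *On the Iwasawa invariants of elliptic curves*, Invent. Math. 142 (2000)
  17–63, §3, Prop. (3.1)–(3.3) (the Manin constants `c₀, c₁`; used only in the consumer's `hNorm`).
  [GreenbergVatsal2000]
* Design of record: cell `b2b-bsdres`, team n1011, `cells/n1011/ROUTE-1.md` §45–§49 (r1), custodian file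
  `T-PORT-1-PKATO.md` STATUS v3–v7 (p13), `HOME/b2b-bsdres-lit-kato/KATO-PAGE-READ-gen5/14/15/16/18.md`
  (image-verified page reads), `PKATO-CITATION-HEADER-gen17.md` + `…-ADDENDUM-gen18.md`.

## Provenance of this file
Typed by the cell's Kato-2004 literature lane (`b2b-bsdres-lit-kato`, gen 19) against r1's binder sheet
ROUTE-1 §47.2 (ST-45b/ST-47a); review lane n1011-lit GEN 21 (print-faithful, register-safe at `3`);
consumer smoke test and binder list in `HOME/b2b-bsdres-lit-kato/gen19/`.  Text of record v1.1 signed by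
r1 (ROUTE-1 §48–§49, binders), n1011-lit GEN 21 (faithfulness; page police 26/26 after the two locator
errata E-L1 (5.7.1) = p. 157 and E-L2 Rem. 12.8 / (12.8.1) = p. 223 applied here, docstrings only) and
this lane (print checklist); filed by gen 20 on the n1011 lead's licence R5-93.  The file asserts nothing
and proves only the two `σ_b` lemmas; no `_holds` is expected for the fact.
-/

noncomputable section

open scoped BigOperators NumberField TensorProduct Pointwise
open Polynomial Complex Field IsDedekindDomain CongruenceSubgroup
open Literature.NumberTheory.GaloisRepresentations
open Literature.NumberTheory.EllipticCurves Literature.NumberTheory.EllipticCurves.ModularForms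

namespace Literature.NumberTheory.EllipticCurves.Kato2004

/-! ## Helper vocabulary (definitions with bodies, two lemmas; no fact, no instance) -/

namespace EulerSystemValues

open Rat.HeightOneSpectrum

/-- The integer `m(k, r) = p^k · ∏_{q ∈ r} ℓ_q` of the cyclotomic level `ℚ(μ_m) = ℚ(μ_{p^k}) · ∏ ℚ(μ_{ℓ_q})`
indexed by `(k, r)` in `cyclotomicLevelsRat p S` (`ℓ_q` the rational prime of the place `q`).
Ref: Kato (2004) §13.1 (`m ∈ Ξ`); Rubin, *Euler Systems* (2000), Ch. III §2.1. [folklore] -/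
def cycLevel (p k : ℕ) (r : Finset (HeightOneSpectrum (𝓞 ℚ))) : ℕ :=
  p ^ k * ∏ q ∈ r, ((primesEquiv q : Nat.Primes) : ℕ)

/-- `m(k, r) ≥ 1` (plumbing for the `NeZero` instance). [folklore] -/
private theorem cycLevel_pos {p : ℕ} (hp : 0 < p) (k : ℕ) (r : Finset (HeightOneSpectrum (𝓞 ℚ))) :
    0 < cycLevel p k r :=
  Nat.mul_pos (Nat.pow_pos hp) (Finset.prod_pos fun q _ ↦ (primesEquiv q).2.pos)

/-- `m(k, r) ≠ 0`, as an instance (needed by the `CyclotomicField`/`DirichletCharacter`/`ZMod` API at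
the level `m(k, r)`). [folklore] -/
instance cycLevel_neZero (p : ℕ) [Fact p.Prime] (k : ℕ) (r : Finset (HeightOneSpectrum (𝓞 ℚ))) :
    NeZero (cycLevel p k r) :=
  ⟨(cycLevel_pos (Fact.out : p.Prime).pos k r).ne'⟩

/-- The level subgroup `Gal(ℚ̄/ℚ(μ_{m(k,r)})) = Gal(ℚ̄/ℚ(μ_{p^k})) ⊓ ⨅_{q ∈ r} Gal(ℚ̄/ℚ(μ_{ℓ_q}))`; it is
`(cyclotomicLevelsRat p S).level k r` for EVERY `S` (`cycSubgroup_eq_level`, `rfl`), written on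
`S = ∅` so that ONE dual-exponential datum serves all auxiliary data `(c, d, a, A)` (binder B7 is
quantified before `c, d, a, A`, order (B) of ROUTE-1 §47.2). [folklore] -/
abbrev cycSubgroup (p : ℕ) [Fact p.Prime] (k : ℕ) (r : Finset (HeightOneSpectrum (𝓞 ℚ))) :
    Subgroup (absoluteGaloisGroup ℚ) :=
  (cyclotomicLevelsRat p (∅ : Set (HeightOneSpectrum (𝓞 ℚ)))).level k r

/-- The level subgroup does not depend on the set of bad places: `cycSubgroup p k r` IS the level
`Gal(K̄/F_k(r))`, `F_k(r) = ℚ(μ_{p^k}) · ∏_{q ∈ r} ℚ(μ_{ℓ_q})`, of `cyclotomicLevelsRat p S` for every `S`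
(definitionally).  Ref: Rubin, *Euler Systems* (2000), Remark 2.1.4 (`F(r) = F · K(q₁)⋯K(q_k)`),
Ch. III §2.1 (`K = ℚ`). [cite: Rubin2000, Remark 2.1.4] -/
theorem cycSubgroup_eq_level (p : ℕ) [Fact p.Prime] (S : Set (HeightOneSpectrum (𝓞 ℚ))) (k : ℕ)
    (r : Finset (HeightOneSpectrum (𝓞 ℚ))) : cycSubgroup p k r = (cyclotomicLevelsRat p S).level k r :=
  rfl

/-- The set of BAD places for the auxiliary data `(c, d, A)` and the level `N`: the places dividing
`2·c·d·A·N`.  The usable (tame) primes of the Euler system are the places outside it and different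
from `p` — Kato's `m ∈ Ξ`, `prime(m) ∩ prime(cdpAN) ⊆ {p}` (Ex. 13.3 p. 225), with `2` removed as well
(design D4: odd tame part only, a SPECIAL CASE of print). [folklore] -/
def badPlaces (c d : ℤ) (A N : ℕ) : Set (HeightOneSpectrum (𝓞 ℚ)) :=
  {v | ((primesEquiv v : Nat.Primes) : ℕ) ∣ 2 * c.natAbs * d.natAbs * A * N}

/-- Membership in `badPlaces`: `v ∣ 2cdAN`, i.e. `v ∈ prime(cdAN) ∪ {2}` — the complement of Kato's
`Ξ`-condition `prime(m) ∩ Σ = {p}`, `Σ = prime(cdpAN)` (Ex. 13.3), up to the place `p` and design D4.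
[cite: Kato2004Asterisque, §13.1 and Ex. 13.3 (pp. 224–225)] -/
@[simp]
theorem mem_badPlaces_iff (c d : ℤ) (A N : ℕ) (v : HeightOneSpectrum (𝓞 ℚ)) :
    v ∈ badPlaces c d A N ↔ ((primesEquiv v : Nat.Primes) : ℕ) ∣ 2 * c.natAbs * d.natAbs * A * N :=
  Iff.rfl

/-- The usable primes of the Euler system of `(c, d, A, N)`: places `v ∤ 2cdAN` with `v ≠ p`, i.e.
the levels are `m = p^k ∏ ℓ` with `prime(m) ∩ prime(cdpAN) ⊆ {p}` (Kato's `Ξ`, §13.1 p. 224 and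
Ex. 13.3 p. 225: `Σ = prime(cdpAN)`) and `2 ∤ ℓ` (design D4, a special case).
[cite: Kato2004Asterisque, §13.1 and Ex. 13.3 (pp. 224–225)] -/
theorem mem_primes_cyclotomicLevelsRat_badPlaces_iff (p : ℕ) [Fact p.Prime] (c d : ℤ) (A N : ℕ)
    (v : HeightOneSpectrum (𝓞 ℚ)) :
    v ∈ (cyclotomicLevelsRat p (badPlaces c d A N)).primes ↔
      ¬ ((primesEquiv v : Nat.Primes) : ℕ) ∣ 2 * c.natAbs * d.natAbs * A * N ∧
        ((primesEquiv v : Nat.Primes) : ℕ) ≠ p :=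
  Iff.rfl

/-- `T := T_p W` as a continuous `ℤ_p`-linear representation of `Γ_ℚ` (the tree's `W.tateGaloisRep p`
with its continuity DISCHARGED by `W.continuous_galoisRepTate_holds p`, Serre 1968 I.1.2).  The
structure facts `ContinuousSMul / Module.Free / Module.Finite ℤ_[p] (W.tateModule p)` are taken as
INSTANCE BINDERS, never as instances (convention of `TateModuleContinuityProofs` "Design" and of the
T-DER files, e.g. `Derivative.exists_sigma_kappa_localImage_tate`); consumers discharge them by
`TateModule.continuousSMul_padicInt`, `W.module_free_tateModule_holds p`,
`W.module_finite_tateModule_holds p`.  Design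
D1 (a): under `W[p]` irreducible this is Kato's lattice `T = V_{ℤ_p}(f)(1)` (§8.3 p. 181, Ex. 13.3) up to
`ℤ_pˣ · p^ℤ` (all stable lattices homothetic under `Irr(W[p])` — elementary, Nakayama; Kato's printed
homothety statement, (12.8.1) p. 223 / Lemma 14.7 p. 238, is under (12.5.2) and is not invoked);
`= T_pE₁` (X₁(N)-optimal curve) by the derivation D-W1 — a reading, not a citation. [folklore] -/
abbrev tateRep (W : WeierstrassCurve ℚ) [W.IsElliptic] (p : ℕ) [Fact p.Prime]
    [ContinuousSMul ℤ_[p] (W.tateModule p)] : GaloisRep ℚ ℤ_[p] (W.tateModule p) :=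
  W.tateGaloisRep p (W.continuous_galoisRepTate_holds p)

variable {N : ℕ} (f : CuspForm (Gamma0 N) 2)

/-- Kato's four-term auxiliary-cusp factor of Thm. 6.6 (1) (`a(A)`-type, `k = 2`, `r = r′ = 1`,
`(u, v) = (1, 1)`, misprints read as (E2)–(E4)), through the modular-symbol dictionary with the PARITY
CROSS-OVER (P1): a character of parity `ε = χ(−1)` sees the cusps `b/A` through the symbols of parity
`−ε` (`even = true ↦ ratMinusSymbol`, `even = false ↦ ratPlusSymbol`).  `χbar` is `χ̄ = χ⁻¹` on `ℤ`;
`d'` is an inverse of `d` modulo `A` (“a/d” = `a d'`, “ac/d” = `a c d'`, Lemma 13.10 (1) p. 230):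
`R^∓_χ = c²d²[a/A]^∓ − cd² χ̄(c)[ac/A]^∓ − c²d χ̄(d)[ad′/A]^∓ + cd χ̄(cd)[acd′/A]^∓`.
Ref: Kato (2004), Thm. 6.6 (1) p. 163, Lemma 13.10 (1) p. 230 (= `LitKatoScratch.cuspFactor` of the
gen-16 probe, shape (β) of record). [folklore] -/
def cuspFactor (even : Bool) (χbar : ℤ → ℂ) (c d a : ℤ) (A : ℕ) (d' : ℤ) : ℂ :=
  let sym : ℚ → ℚ := if even then ratMinusSymbol f else ratPlusSymbol f
  ((c : ℂ) ^ 2 * (d : ℂ) ^ 2) * ((sym ((a : ℚ) / A) : ℚ) : ℂ)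
    - ((c : ℂ) * (d : ℂ) ^ 2) * χbar c * ((sym ((a * c : ℚ) / A) : ℚ) : ℂ)
    - ((c : ℂ) ^ 2 * (d : ℂ)) * χbar d * ((sym ((a * d' : ℚ) / A) : ℚ) : ℂ)
    + ((c : ℂ) * (d : ℂ)) * χbar (c * d) * ((sym ((a * c * d' : ℚ) / A) : ℚ) : ℂ)

set_option backward.isDefEq.respectTransparency false in
/-- `σ_b ∈ Gal(ℚ(ζ_m)/ℚ)` with `σ_b(ζ) = ζ^b` for every `m`-th root of unity `ζ` (Kato, Prop. 5.3 (1)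
p. 155 / (5.7.1) p. 157: `(b 0; 0 1)^* = σ_b`, `σ_b(ζ_m) = ζ_m^b`), via Mathlib's
`IsCyclotomicExtension.autEquivPow`; see `sigma_apply_of_pow_eq_one` for the defining property.
[folklore] -/
def sigma (m : ℕ) [NeZero m] (b : (ZMod m)ˣ) : CyclotomicField m ℚ ≃ₐ[ℚ] CyclotomicField m ℚ :=
  (IsCyclotomicExtension.autEquivPow (CyclotomicField m ℚ)
      (cyclotomic.irreducible_rat (NeZero.pos m))).symm b

set_option backward.isDefEq.respectTransparency false in
/-- `σ_b` raises the distinguished primitive root `ζ = zeta m ℚ ℚ(ζ_m)` to the power `b`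
(Kato (5.7.1) p. 157: `σ_b(ζ_m) = ζ_m^b` — NOT `ζ_m^{b⁻¹}`; r1's companion check of ROUTE-1 §47.2 B5).
[cite: Kato2004Asterisque, (5.7.1) (p. 157)] -/
theorem sigma_apply_zeta (m : ℕ) [NeZero m] (b : (ZMod m)ˣ) :
    sigma m b (IsCyclotomicExtension.zeta m ℚ (CyclotomicField m ℚ)) =
      IsCyclotomicExtension.zeta m ℚ (CyclotomicField m ℚ) ^ (b : ZMod m).val := by
  have key :=
    (IsCyclotomicExtension.zeta_spec m ℚ (CyclotomicField m ℚ)).autToPow_spec ℚ (sigma m b)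
  rw [← key]
  congr 2
  have h1 : IsCyclotomicExtension.autEquivPow (CyclotomicField m ℚ)
      (cyclotomic.irreducible_rat (NeZero.pos m)) (sigma m b) = b := by
    rw [sigma, MulEquiv.apply_symm_apply]
  exact congrArg Units.val h1

set_option backward.isDefEq.respectTransparency false in
/-- `σ_b(μ) = μ^b` for EVERY `m`-th root of unity `μ ∈ ℚ(ζ_m)` (Kato (5.7.1) p. 157).
[cite: Kato2004Asterisque, (5.7.1) (p. 157)] -/
theorem sigma_apply_of_pow_eq_one (m : ℕ) [NeZero m] (b : (ZMod m)ˣ) (μ : CyclotomicField m ℚ)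
    (hμ : μ ^ m = 1) : sigma m b μ = μ ^ (b : ZMod m).val := by
  obtain ⟨i, -, rfl⟩ :=
    (IsCyclotomicExtension.zeta_spec m ℚ (CyclotomicField m ℚ)).eq_pow_of_pow_eq_one hμ
  rw [map_pow, sigma_apply_zeta, ← pow_mul, ← pow_mul, mul_comm]

/-- Kato's character sum `Σ_{b ∈ (ℤ/m)ˣ} χ(b) · ι(σ_b x)` of `x ∈ ℚ(ζ_m)` under an embedding
`ι : ℚ(ζ_m) → ℂ` (left side of Thm. 6.6 (1), p. 163, after `per_f(σ_b(x·f̄)) = ι(σ_b x)·per(f)`;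
= `LitKatoScratch.charSum`). [folklore] -/
def charSum (m : ℕ) [NeZero m] (ι : CyclotomicField m ℚ →+* ℂ) (χ : DirichletCharacter ℂ m)
    (x : CyclotomicField m ℚ) : ℂ :=
  ∑ b : (ZMod m)ˣ, χ (b : ZMod m) * ι (sigma m b x)

/-- "`L` is the entire continuation of Kato's `S`-depleted twisted series": Kato (2004) §6.2, p. 161:
"For `m ≥ 1` and for a finite set `S` of prime numbers such that `prime(m) ⊂ S`, and for a character
`χ : (ℤ/m)^× → ℂ^×`, let `L_S(f, χ, s) = Σ_{(n,S)=1} a_n χ(n) n^{−s}` […]. These zeta functions converge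
absolutely when `Re(s) > (k + 1)/2`, and are extended as holomorphic functions to the whole `s`-plane."
Here (`k = 2`, `S = prime(m·M)`): `L` is entire and agrees on `Re s > 2` with the tree's `twistedLSeries`
of `χ` induced to modulus `m·M` (`χ(n) := 0` unless `(n, mM) = 1`).  A predicate (the continuation is a
parameter `L`, as in `KatoTwistedFiniteness`); nothing asserted (= `LitKatoScratch.IsDepletedTwistedL`
with the second modulus made explicit). [cite: Kato2004Asterisque, §6.2 (p. 161)] -/
def IsDepletedTwistedL (m M : ℕ) (χ : DirichletCharacter ℂ m) (L : ℂ → ℂ) : Prop :=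
  Differentiable ℂ L ∧
    ∀ s : ℂ, 2 < s.re → L s = twistedLSeries f (DirichletCharacter.changeLevel (dvd_mul_right m M) χ) s

end EulerSystemValues

open EulerSystemValues Rat.HeightOneSpectrum

/-! ## The matrix `ZetaBody` (ROUTE-1 §47.2 (A)/(D): conjuncts C1–C5, parameters explicit, no `∃`) -/

/-- **The matrix of Kato's Example 13.3 / (8.1.3) for `T_pW` (binder sheet ROUTE-1 §47.2 (D), C1–C5)** —
a plain predicate on explicit witnesses: the dual-exponential value datum `Λ = (Λ_{k,r})` (per level
`m = p^k ∏_{q∈r} ℓ_q`, a `ℤ_p`-linear map `H¹(ℚ(μ_m), T_pW) → ℚ_p ⊗_ℚ ℚ(ζ_m)`, read as `exp*_{f̄} ∘ loc_p`),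
the real constant `κ`, the classes `z = (z_{k,r})` over the cyclotomic levels of `(c, d, A, N)` and the
rational values `x = (x_{k,r})`, `x_{k,r} ∈ ℚ(ζ_m)`; `ι = (ι_m)` are complex embeddings of the `ℚ(ζ_m)`.
It says: (C1) `z` is an Euler system in Rubin's sense for `T_pW` over `cyclotomicLevelsRat p (badPlaces c d A N)`,
on ALL levels `m = p^k · ∏_{q ∈ r} ℓ_q`, `k ≥ 0` [(8.1.2)–(8.1.3) p. 180 (every `m ≥ 1`, `p ∈ S_m`,
`S_m := prime(m·p·A)`) + Prop. 8.12 p. 186 (the norm relation for every `m ∣ m′`, Euler factors over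
`S_{m′} ∖ S_m`: none at a `p`-step, `P_ℓ(ℓ⁻¹σ_ℓ⁻¹)` = the tree's `eulerFactorOp` at a tame step `ℓ`);
Ex. 13.3 / (13.1.1) pp. 224–225 for the guards on `c, d` and `Σ = prime(cdpAN)`]; (C2) every `z_{k,r}` is UNRAMIFIED AWAY FROM `p` at
class level: its restriction to `I_𝔓 ∩ Gal(ℚ̄/ℚ(μ_m))` vanishes for every prime `𝔓` of `ℤ̄` over a place
`v ≠ p` — places over `N`, `m`, `cdA` included [(8.1.3): `z_m ∈ H¹(ℤ[ζ_m, 1/p], T)`, with §8.2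
pp. 180–181 and Lemma 8.5 pp. 183–184]; (C3) the datum axioms [readings of §9.4, NOT separately printed;
own attribution]: `Λ_{k,r}` is `Gal(ℚ(μ_m)/ℚ)`-equivariant (`σ` acting on `H¹` by transport of structure,
`conjMap`, and on `ℚ(ζ_m)` by `σ_{χ_m(σ)}`) and LOCAL AT `p` (it kills every class whose restrictions to
the decomposition groups `D_𝔓 ∩ Gal(ℚ̄/ℚ(μ_m))`, `𝔓 ∣ p`, vanish); (C4) RATIONALITY [Thm. 9.7 p. 189]:
`Λ_{k,r}(z_{k,r}) = 1 ⊗ x_{k,r}`; (C5) the VALUE LAW [Thm. 9.7 ∘ Thm. 6.6 (1) p. 163 with (E1)–(E4),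
`S = prime(m·p·A)`, shape (β), parity cross-over (P1), one constant (P2)]: for every level with
`(cd, mA) = 1` [(8.1.2): `prime(cd) ∩ S = ∅`], every `d′` with `dd′ ≡ 1 (A)`, every Dirichlet character
`χ` mod `m` and every entire continuation `L` of `Σ_{(n,mpA)=1} a_nχ(n)n^{-s}`:
`Σ_b χ(b) ι_m(σ_b x_{k,r}) = κ · L(1)/Ω⁺_f · R⁻_χ` if `χ(−1) = 1`, `= −κ · L(1)/(iΩ⁻_f) · R⁺_χ` if
`χ(−1) = −1`.  The predicate pins NO sign relation between even- and odd-character values: the witness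
map `(κ, Λ, z, x) ↦ (κ, (1 ⊗ σ₋₁) ∘ Λ, z, σ₋₁ x)` preserves (C1)–(C4) and flips every odd clause of (C5)
(n1011-lit GEN 21), so no consumer may read one — nor any `χ̄(j)`-twist relation between values at
different characters; likewise a change of the embeddings `ι` is absorbed LEVEL-WISE by the witnesses
(F-ι-0) — sound because this predicate has NO cross-level axiom on `Λ` or `x` (rider R-ι: keep it so).
Nothing is asserted by this definition; the consumer's row ENDs bind the witnesses
explicitly as `(hbody : ZetaBody W p f ι κ Λ c d a A z x)` (finding F-wit).  A PREDICATE (parameters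
explicit, no `∃`); the cited statements are transcribed clause by clause as listed.
[cite: Kato2004Asterisque, (8.1.3) (p. 180), §8.2 and Lemma 8.5 (pp. 180–184), Prop. 8.12 (p. 186), Thm. 9.7 (p. 189), Thm. 6.6 (1) (p. 163), §13.1 (13.1.1) and Ex. 13.3 (pp. 224–225)]
[cite: Rubin2000, Def. 2.1.1 and Remark 2.1.4] -/
def ZetaBody (W : WeierstrassCurve ℚ) [W.IsElliptic] (p : ℕ) [Fact p.Prime]
    [ContinuousSMul ℤ_[p] (W.tateModule p)] [Module.Free ℤ_[p] (W.tateModule p)]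
    [Module.Finite ℤ_[p] (W.tateModule p)] {N : ℕ} (f : CuspForm (Gamma0 N) 2) (ι : (m : ℕ) → (CyclotomicField m ℚ →+* ℂ)) (κ : ℝ)
    (Λ : ∀ (k : ℕ) (r : Finset (HeightOneSpectrum (𝓞 ℚ))),
      H1 (tateRep W p) (cycSubgroup p k r) →ₗ[ℤ_[p]] ℚ_[p] ⊗[ℚ] CyclotomicField (cycLevel p k r) ℚ)
    (c d a : ℤ) (A : ℕ)
    (z : ∀ (k : ℕ) (r : (cyclotomicLevelsRat p (badPlaces c d A N)).Ideals),
      H1 (tateRep W p) ((cyclotomicLevelsRat p (badPlaces c d A N)).level k r.1))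
    (x : ∀ (k : ℕ) (r : (cyclotomicLevelsRat p (badPlaces c d A N)).Ideals),
      CyclotomicField (cycLevel p k r.1) ℚ) : Prop :=
  let T := tateRep W p
  let L := cyclotomicLevelsRat p (badPlaces c d A N)
  -- (C1) Euler system, ALL levels `k ≥ 0` [(8.1.2)–(8.1.3) p. 180 every `m ≥ 1` + Prop. 8.12 p. 186;
  --      Ex. 13.3 / (13.1.1) for the guards and `Σ`; form (L-b′) of ROUTE-1 §48.1]
  IsEulerSystem L T p z ∧
  -- (C2) unramified away from `p`, class level [(8.1.3) with §8.2 + Lemma 8.5]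
  (∀ (k : ℕ) (r : L.Ideals) (v : HeightOneSpectrum (𝓞 ℚ)), ((primesEquiv v : Nat.Primes) : ℕ) ≠ p →
      ∀ 𝔓 ∈ v.primesAbove,
        resLe T.toTopRep
            (inf_le_left : L.level k r.1 ⊓ 𝔓.inertia (absoluteGaloisGroup ℚ) ≤ L.level k r.1)
            1 (z k r) = 0) ∧
  -- (C3a) datum axiom X1-eq: `Gal(ℚ(μ_m)/ℚ)`-equivariance of `Λ`  [reading of §9.4; own attribution]
  (∀ (k : ℕ) (r : Finset (HeightOneSpectrum (𝓞 ℚ))) (σ : absoluteGaloisGroup ℚ)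
      (y : H1 T (cycSubgroup p k r)),
      Λ k r (conjMap T.toTopRep (cycSubgroup p k r) σ 1 y) =
        Algebra.TensorProduct.map (AlgHom.id ℚ ℚ_[p])
          (sigma (cycLevel p k r) (modNCyclotomicCharacter ℚ (cycLevel p k r) σ) :
            CyclotomicField (cycLevel p k r) ℚ →ₐ[ℚ] CyclotomicField (cycLevel p k r) ℚ)
          (Λ k r y)) ∧
  -- (C3b) datum axiom X1-loc (the typable half of X2): `Λ` is LOCAL AT `p`  [§9.4; own attribution]
  (∀ (k : ℕ) (r : Finset (HeightOneSpectrum (𝓞 ℚ))) (y : H1 T (cycSubgroup p k r)),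
      (∀ v : HeightOneSpectrum (𝓞 ℚ), ((primesEquiv v : Nat.Primes) : ℕ) = p →
        ∀ 𝔓 ∈ v.primesAbove,
          resLe T.toTopRep
              (inf_le_left : cycSubgroup p k r ⊓ MulAction.stabilizer (absoluteGaloisGroup ℚ) 𝔓 ≤
                cycSubgroup p k r)
              1 y = 0) →
      Λ k r y = 0) ∧
  -- (C4) rationality / the one declared coordinate [Thm. 9.7]
  (∀ (k : ℕ) (r : L.Ideals), Λ k r.1 (z k r) = (1 : ℚ_[p]) ⊗ₜ[ℚ] x k r) ∧
  -- (C5) value law [Thm. 9.7 ∘ Thm. 6.6 (1)], `S = prime(m·p·A)`, shape (β)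
  (∀ (k : ℕ) (r : L.Ideals) (d' : ℤ) (χ : DirichletCharacter ℂ (cycLevel p k r.1)) (Lχ : ℂ → ℂ),
      Int.gcd (c * d) (cycLevel p k r.1 * A) = 1 →
      d * d' ≡ 1 [ZMOD (A : ℤ)] →
      IsDepletedTwistedL f (cycLevel p k r.1) (p * A) χ Lχ →
        (χ (-1) = 1 →
          charSum (cycLevel p k r.1) (ι (cycLevel p k r.1)) χ (x k r) =
            (κ : ℂ) * (Lχ 1 / (plusPeriod f : ℂ)) *
              cuspFactor f true (fun n ↦ χ⁻¹ (n : ZMod (cycLevel p k r.1))) c d a A d') ∧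
        (χ (-1) = -1 →
          charSum (cycLevel p k r.1) (ι (cycLevel p k r.1)) χ (x k r) =
            -(κ : ℂ) * (Lχ 1 / (Complex.I * (minusPeriod f : ℂ))) *
              cuspFactor f false (fun n ↦ χ⁻¹ (n : ZMod (cycLevel p k r.1))) c d a A d'))

/-! ## The fact (ROUTE-1 §47.2 (A)/(B): `∀ B1–B5, ∃ κ ≠ 0, ∃ Λ, ∀ c d a A (guards), ∃ z x, ZetaBody …`) -/

/-- **Kato 2004, (8.1.3) / Example 13.3 (`a(A)`-type, `k = 2`, `F = ℚ`) with Prop. 8.12, §8.2/Lemma 8.5,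
Thm. 9.7 and Thm. 6.6 (1), for the newform of an elliptic curve `W/ℚ` with `W[p]` irreducible** (text
of record: the module docstring above = citation header gen 17 §1–§2 with addenda (H1)–(H4); statement
signed ROUTE-1 §48–§49 / n1011-lit GEN 21).  For every elliptic curve `W/ℚ`, every prime `p`
[the structure facts `ContinuousSMul / Module.Free / Module.Finite ℤ_[p] (T_pW)` are instance BINDERS,
discharged by the tree theorems — convention of the `TateModule*Proofs` files, never instances]
with `W[p]` irreducible (D1 (a): places Kato's lattice `V_{ℤ_p}(f)(1)` on `T_pW` up to `ℤ_pˣ·p^ℤ` —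
all stable lattices are homothetic under `Irr(W[p])`, elementary (Nakayama); Kato's printed homothety
statement (12.8.1) p. 223 / Lemma 14.7 p. 238 is under (12.5.2) and is not invoked — by F-κ no parity of
`p` is needed for this), its newform `f ∈ S₂(Γ₀(N))` and every family of
complex embeddings `ι_m : ℚ(ζ_m) → ℂ`, there are ONE real constant `κ ≠ 0` (P2) and ONE dual-exponential
value datum `Λ` on the cyclotomic levels such that for all integers `c, d` and `a ∈ ℤ`, `A ≥ 1` with
`(c, 6pA) = 1`, `(d, 6pN) = 1` (Ex. 13.3 p. 225) there exist classes `z_m ∈ H¹(ℚ(μ_m), T_pW)` on all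
levels `m = p^k·∏ℓ`, `k ≥ 0`, `ℓ ∤ 2cdpAN` distinct primes [(8.1.3) p. 180: every `m ≥ 1`, `p ∈ S`;
squarefree odd tame part = SPECIAL CASE of print, design D4], and values `x_m ∈ ℚ(ζ_m)`, satisfying
`ZetaBody`: norm relations (Prop. 8.12 / (13.1.1)), unramifiedness away from `p` ((8.1.3), §8.2,
Lemma 8.5), the datum axioms (readings of §9.4), rationality (Thm. 9.7) and the value law (Thm. 9.7 ∘
Thm. 6.6 (1), (E1)–(E4), (P1)).  Hypotheses transcribed: NONE on the reduction of `W` at `p`, none on the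
image beyond `W[p]` irreducible, `p ∣ N` and `p = 2` allowed.  NOT here: the definition of the classes
(§§2, 8), `exp*` as a map (§9.4), any integrality or Bloch–Kato-kernel statement about `Λ` (the consumer's
`hIdx`, [BK90]/local duality — not Kato), any `ω_E`-normalisation of `κ` (the consumer's `hNorm`, R-κ),
Thm. 12.5/12.6, any divisibility, any Kolyvagin-type statement, any proof.  Named fact; nothing asserted;
no `_holds` expected.
[cite: Kato2004Asterisque, (8.1.3) (p. 180), §8.2 (pp. 180–181), Lemma 8.5 (pp. 183–184), Prop. 8.12 (p. 186), §9.4 (p. 188), Thm. 9.7 (p. 189), §6.2–6.3 (pp. 161–162), Thm. 6.6 (1) (p. 163), (4.2.4) (p. 143), §5.5 (p. 156), (5.7.1) (p. 157), (7.13.5)–(7.13.6) (p. 169), §13.1 (13.1.1), Ex. 13.3 (pp. 224–225), Lemma 13.10–13.11 (pp. 230–231), §8.3 (p. 181), (12.8.1) (p. 223), Lemma 14.7 (p. 238)]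
[cite: Rubin2000, Def. 2.1.1 and Remark 2.1.4] -/
def exists_eulerSystem_expStar_values : Prop :=
  ∀ (W : WeierstrassCurve ℚ) [W.IsElliptic] (p : ℕ) [Fact p.Prime]
    [ContinuousSMul ℤ_[p] (W.tateModule p)] [Module.Free ℤ_[p] (W.tateModule p)]
    [Module.Finite ℤ_[p] (W.tateModule p)],
    W.HasIrreducibleModPGaloisRep p →
    ∀ {N : ℕ} [NeZero N] (f : CuspForm (Gamma0 N) 2), IsNewformOf W f →
    ∀ (ι : (m : ℕ) → (CyclotomicField m ℚ →+* ℂ)),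
    ∃ κ : ℝ, κ ≠ 0 ∧
    ∃ Λ : ∀ (k : ℕ) (r : Finset (HeightOneSpectrum (𝓞 ℚ))),
        H1 (tateRep W p) (cycSubgroup p k r) →ₗ[ℤ_[p]] ℚ_[p] ⊗[ℚ] CyclotomicField (cycLevel p k r) ℚ,
    ∀ (c d a : ℤ) (A : ℕ), 0 < A → Int.gcd c (6 * p * A) = 1 → Int.gcd d (6 * p * N) = 1 →
      ∃ (z : ∀ (k : ℕ) (r : (cyclotomicLevelsRat p (badPlaces c d A N)).Ideals),
            H1 (tateRep W p) ((cyclotomicLevelsRat p (badPlaces c d A N)).level k r.1))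
        (x : ∀ (k : ℕ) (r : (cyclotomicLevelsRat p (badPlaces c d A N)).Ideals),
            CyclotomicField (cycLevel p k r.1) ℚ),
        ZetaBody W p f ι κ Λ c d a A z x

-- TODO(general form): Kato (8.1.3)/Ex. 13.3 for every `m ≥ 1` (non-squarefree tame part, even `m`),
-- for `ξ ∈ SL₂(ℤ)` (value law with `c ≡ d ≡ 1 mod N`), for newforms of weight `k ≥ 2` with
-- coefficients (`F ≠ ℚ`, `T = V_{O_λ}(f)(k − r)`, `1 ≤ j ≤ k − 1`), and with `exp*` a DEFINED map
-- (semi-local `H¹(ℚ(ζ_m) ⊗ ℚ_p, V) → S(f) ⊗ ℚ_p ⊗ ℚ(ζ_m)`) once `D_dR` is in the tree.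

end Literature.NumberTheory.EllipticCurves.Kato2004

end
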